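import Literature.AlgebraicGeometry.Motives.VarietiesProjectiveSpaceProofs
import Literature.AlgebraicGeometry.Motives.ProjectiveLineInvolution
import Mathlib.Algebra.Polynomial.Laurent
import Mathlib.RingTheory.Localization.Basic
import Mathlib.RingTheory.Adjoin.Polynomial.Basic
import Mathlib.Algebra.MonoidAlgebra.Module
import HarnessLib

/-!
# The two standard charts of `ℙ¹_k` and the Laurent structure on their overlap

Topic: `Literature/AlgebraicGeometry/FundamentalGroup`. Bookkeeping for the standard affine cover
of `ℙ¹_k = Proj k[x₀, x₁]` (Hartshorne II Prop. 2.5 (b); Görtz–Wedhorn I §(11.17): `U₀ = Spec k[T]`,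
`U₁ = Spec k[T⁻¹]`, `U₀ ∩ U₁ = Spec k[T, T⁻¹]`), at the level of Mathlib's homogeneous
localisations `A₀ = (k[x]_{x₀})₀`, `A₁ = (k[x]_{x₁})₀`, `Λ = (k[x]_{x₀x₁})₀` and the maps
`awayMap` between them (`res₀`, `res₁`), as consumed by the lattice proof that `ℙ¹_k` is simply
connected (`ProjectiveLineLattices.lean`):

* `tgen = x₁/x₀`, `sgen = x₀/x₁`; `isLocalization₀/₁`: `Λ = A₀[1/t] = A₁[1/s]` (Mathlib
  `HomogeneousLocalization.Away.isLocalization_mul`); `res₀ t · res₁ s = 1`;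
* `polyEquiv i : k[X] ≃ₐ[k] Aᵢ` (the fleet's `ProjectiveSpace.chartAlgEquiv`, univariate);
* `laurentEquiv : k[T;T⁻¹] ≃+* Λ` (`IsLocalization.ringEquivOfRingEquiv`), `laurentAlgEquiv`;
* `ℓ : Basis ℤ k Λ`, `ℓ j = t^j`, multiplicative (`ℓ_mul`, `ℓ_zero`, `ℓ_one = res₀ t`,
  `ℓ_neg_one = res₁ s`);
* `range_res₀ = span_k {ℓ j | j ≥ 0}` (= `k[t]`), `range_res₁ = span_k {ℓ j | j ≤ 0}` (= `k[t⁻¹]`);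
* `Proj.basicOpen_mul_eq_basicOpen_awayToSection` (any `Proj`): `D₊(f g)` is the basic open of
  the section `g^{deg f}/f^{deg g}` over `D₊(f)` — so that `Γ(π⁻¹ D₊(x₀x₁))` is a localisation of
  `Γ(π⁻¹ D₊(x₀))` for any `π : Y → ℙ¹` (Mathlib `IsAffineOpen.isLocalization_of_eq_basicOpen`).

## Sources

* R. Hartshorne, *Algebraic Geometry* (1977), II Prop. 2.5 (b). [Hartshorne1977]
* U. Görtz, T. Wedhorn, *Algebraic Geometry I*, 2nd ed. (2020), §(11.17). [GortzWedhorn2020]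
-/

noncomputable section

open MvPolynomial HomogeneousLocalization

namespace Literature.AlgebraicGeometry.FundamentalGroup

namespace P1Charts

universe u

variable (k : Type u) [Field k]

attribute [local instance] MvPolynomial.gradedAlgebra
  Literature.AlgebraicGeometry.Motives.ProjBaseChange.algebraBase

open Literature.AlgebraicGeometry.Motives (ProjBaseChange.algebraBase)
open Literature.AlgebraicGeometry.Motives.ProjectiveSpace (X_mem chartGen chartAlgEquiv
  chartAlgEquiv_symm_X)

local notation "𝒜" => MvPolynomial.homogeneousSubmodule (Fin 2) k
local notation "A₀" => Away (MvPolynomial.homogeneousSubmodule (Fin 2) k) (X 0 : MvPolynomial (Fin 2) k)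
local notation "A₁" => Away (MvPolynomial.homogeneousSubmodule (Fin 2) k) (X 1 : MvPolynomial (Fin 2) k)
local notation "Λ" => Away (MvPolynomial.homogeneousSubmodule (Fin 2) k)
  (X 0 * X 1 : MvPolynomial (Fin 2) k)

/-- `x₀ x₁ = x₀ · x₁` (the shape `x = f g` Mathlib's `awayMap` wants, chart `x₀`). [folklore] -/
theorem hx₀ : (X 0 * X 1 : MvPolynomial (Fin 2) k) = X 0 * X 1 := rfl

/-- `x₀ x₁ = x₁ · x₀` (chart `x₁`). [folklore] -/
theorem hx₁ : (X 0 * X 1 : MvPolynomial (Fin 2) k) = X 1 * X 0 := mul_comm _ _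

/-- The restriction `(k[x]_{x₀})₀ → (k[x]_{x₀x₁})₀`, `a/x₀ⁱ ↦ a x₁ⁱ/(x₀x₁)ⁱ`. [folklore] -/
abbrev res₀ : A₀ →+* Λ := awayMap _ (X_mem (R := k) (1 : Fin 2)) (hx₀ k)

/-- The restriction `(k[x]_{x₁})₀ → (k[x]_{x₀x₁})₀`. [folklore] -/
abbrev res₁ : A₁ →+* Λ := awayMap _ (X_mem (R := k) (0 : Fin 2)) (hx₁ k)

/-- `t = x₁/x₀ ∈ (k[x]_{x₀})₀`. [folklore] -/
abbrev tgen : A₀ := chartGen k (0 : Fin 2) 0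

/-- `s = x₀/x₁ ∈ (k[x]_{x₁})₀`. [folklore] -/
abbrev sgen : A₁ := chartGen k (1 : Fin 2) 0

/-- Mathlib's localisation element `x₁¹/x₀¹` is `t`. [folklore] -/
theorem isLocalizationElem_eq_tgen :
    Away.isLocalizationElem (X_mem (R := k) (0 : Fin 2)) (X_mem (R := k) (1 : Fin 2)) = tgen k := by
  apply val_injective
  simp [chartGen, Away.val_mk]

/-- Mathlib's localisation element `x₀¹/x₁¹` is `s`. [folklore] -/
theorem isLocalizationElem_eq_sgen :
    Away.isLocalizationElem (X_mem (R := k) (1 : Fin 2)) (X_mem (R := k) (0 : Fin 2)) = sgen k := by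
  apply val_injective
  simp [chartGen, Away.val_mk]

/-- `(k[x]_{x₀x₁})₀ = (k[x]_{x₀})₀[1/t]` (Mathlib `Away.isLocalization_mul`). [folklore] -/
theorem isLocalization₀ :
    letI := (res₀ k).toAlgebra
    IsLocalization.Away (tgen k) Λ := by
  rw [← isLocalizationElem_eq_tgen]
  exact Away.isLocalization_mul _ _ (hx₀ k) one_ne_zero

/-- `(k[x]_{x₀x₁})₀ = (k[x]_{x₁})₀[1/s]`. [folklore] -/
theorem isLocalization₁ :
    letI := (res₁ k).toAlgebra
    IsLocalization.Away (sgen k) Λ := by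
  rw [← isLocalizationElem_eq_sgen]
  exact Away.isLocalization_mul _ _ (hx₁ k) one_ne_zero

/-- `t · s = 1` in `(k[x]_{x₀x₁})₀`. [folklore] -/
theorem res₀_tgen_mul_res₁_sgen : res₀ k (tgen k) * res₁ k (sgen k) = 1 := by
  apply val_injective
  rw [val_mul, val_one]
  simp only [chartGen, awayMap_mk, Away.val_mk, Localization.mk_mul]
  rw [← Localization.mk_one, Localization.mk_eq_mk_iff, Localization.r_iff_exists]
  exact ⟨1, by simp; ring⟩

/-- The restrictions are `k`-algebra maps. [folklore] -/
theorem res₀_algebraMap (c : k) : res₀ k (algebraMap k A₀ c) = algebraMap k Λ c :=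
  awayMap_fromZeroRingHom _ _ _ _

/-- The restrictions are `k`-algebra maps. [folklore] -/
theorem res₁_algebraMap (c : k) : res₁ k (algebraMap k A₁ c) = algebraMap k Λ c :=
  awayMap_fromZeroRingHom _ _ _ _

/-! ### The charts as polynomial rings -/

/-- `k[X] ≅ (k[x₀,x₁]_{xᵢ})₀`, `X ↦ x_{i.succAbove 0}/xᵢ` (the fleet's `chartAlgEquiv`, univariate).
[folklore] -/
def polyEquiv (i : Fin 2) :
    Polynomial k ≃ₐ[k] Away (MvPolynomial.homogeneousSubmodule (Fin 2) k) (X i : MvPolynomial (Fin 2) k) :=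
  (MvPolynomial.uniqueAlgEquiv k (Fin 1)).symm.trans (chartAlgEquiv k i).symm

/-- `polyEquiv` sends `X` to `x_{i.succAbove 0}/xᵢ`. [folklore] -/
theorem polyEquiv_X (i : Fin 2) : polyEquiv k i Polynomial.X = chartGen k i 0 := by
  simp [polyEquiv, MvPolynomial.uniqueAlgEquiv_symm_apply, Fin.default_eq_zero]


/-- The restriction `(k[x]_{x₀})₀ → (k[x]_{x₀x₁})₀` as a `k`-algebra map. [folklore] -/
def res₀ₐ : A₀ →ₐ[k] Λ where
  toRingHom := res₀ k
  commutes' := res₀_algebraMap k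

/-- The restriction `(k[x]_{x₁})₀ → (k[x]_{x₀x₁})₀` as a `k`-algebra map. [folklore] -/
def res₁ₐ : A₁ →ₐ[k] Λ where
  toRingHom := res₁ k
  commutes' := res₁_algebraMap k

/-! ### The Laurent structure on the overlap `(k[x₀,x₁]_{x₀x₁})₀ ≅ k[t, t⁻¹]` -/

open LaurentPolynomial in
/-- `k[T;T⁻¹] ≅ (k[x₀,x₁]_{x₀x₁})₀`: both are the localisation of `k[X] ≅ (k[x]_{x₀})₀` away from
`X ↔ t = x₁/x₀` (Mathlib `IsLocalization.ringEquivOfRingEquiv`). [folklore] -/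
def laurentEquiv : LaurentPolynomial k ≃+* Λ :=
  letI := (res₀ k).toAlgebra
  haveI := isLocalization₀ k
  IsLocalization.ringEquivOfRingEquiv (M := Submonoid.powers (Polynomial.X : Polynomial k))
    (T := Submonoid.powers (tgen k)) (LaurentPolynomial k) Λ (polyEquiv k 0).toRingEquiv
    (by rw [Submonoid.map_powers]; simp [polyEquiv_X])

/-- `laurentEquiv` on polynomials: `p ↦ res₀ (polyEquiv p)`. [folklore] -/
theorem laurentEquiv_toLaurent (p : Polynomial k) :
    laurentEquiv k (Polynomial.toLaurent p) = res₀ k (polyEquiv k 0 p) := by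
  letI := (res₀ k).toAlgebra
  haveI := isLocalization₀ k
  exact IsLocalization.ringEquivOfRingEquiv_eq _ _

/-- `laurentEquiv (T) = t`. [folklore] -/
theorem laurentEquiv_T_one : laurentEquiv k (LaurentPolynomial.T 1) = res₀ k (tgen k) := by
  rw [← Polynomial.toLaurent_X, laurentEquiv_toLaurent, polyEquiv_X]

/-- `laurentEquiv` is `k`-linear on constants. [folklore] -/
theorem laurentEquiv_C (c : k) : laurentEquiv k (LaurentPolynomial.C c) = algebraMap k Λ c := by
  rw [← Polynomial.toLaurent_C, laurentEquiv_toLaurent, Polynomial.C_eq_algebraMap,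
    AlgEquiv.commutes, res₀_algebraMap]

/-- `laurentEquiv` as a `k`-algebra isomorphism. [folklore] -/
def laurentAlgEquiv : LaurentPolynomial k ≃ₐ[k] Λ :=
  { laurentEquiv k with
    commutes' := fun c => by
      rw [← laurentEquiv_C]
      rfl }

/-- Unfolding of `laurentAlgEquiv`. [folklore] -/
@[simp] theorem laurentAlgEquiv_apply (f : LaurentPolynomial k) :
    laurentAlgEquiv k f = laurentEquiv k f := rfl

/-- `laurentEquiv (T⁻¹) = s` (the inverse of `t`). [folklore] -/
theorem laurentEquiv_T_neg_one : laurentEquiv k (LaurentPolynomial.T (-1)) = res₁ k (sgen k) := by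
  have h1 : laurentEquiv k (LaurentPolynomial.T (-1)) * laurentEquiv k (LaurentPolynomial.T 1) = 1 := by
    rw [← map_mul, ← LaurentPolynomial.T_add]; simp
  have h2 := res₀_tgen_mul_res₁_sgen k
  rw [← laurentEquiv_T_one] at h2
  calc laurentEquiv k (LaurentPolynomial.T (-1))
      = laurentEquiv k (LaurentPolynomial.T (-1)) *
          (laurentEquiv k (LaurentPolynomial.T 1) * res₁ k (sgen k)) := by rw [h2, mul_one]
    _ = res₁ k (sgen k) := by rw [← mul_assoc, h1, one_mul]

/-- **The Laurent basis of the overlap**: `ℓ j = t^j`, the image of `T^j ∈ k[T;T⁻¹]`.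
[folklore] -/
def ℓ : Module.Basis ℤ k Λ :=
  (AddMonoidAlgebra.basis ℤ k).map (laurentAlgEquiv k).toLinearEquiv

/-- `ℓ j = laurentEquiv (T j)`. [folklore] -/
theorem ℓ_apply (j : ℤ) : ℓ k j = laurentEquiv k (LaurentPolynomial.T j) := by
  rw [ℓ, Module.Basis.map_apply, AddMonoidAlgebra.basis_apply]
  rfl

/-- `ℓ` is multiplicative. [folklore] -/
theorem ℓ_mul (i j : ℤ) : ℓ k i * ℓ k j = ℓ k (i + j) := by
  simp only [ℓ_apply, ← map_mul, ← LaurentPolynomial.T_add]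

/-- `ℓ 0 = 1`. [folklore] -/
theorem ℓ_zero : ℓ k 0 = 1 := by
  simp [ℓ_apply]

/-- `ℓ 1 = t`. [folklore] -/
theorem ℓ_one : ℓ k 1 = res₀ k (tgen k) := by rw [ℓ_apply, laurentEquiv_T_one]

/-- `ℓ (-1) = s`. [folklore] -/
theorem ℓ_neg_one : ℓ k (-1) = res₁ k (sgen k) := by rw [ℓ_apply, laurentEquiv_T_neg_one]

/-! ### The images of the two charts: `k[t]` and `k[t⁻¹]` -/

open LaurentPolynomial in
/-- In `k[T;T⁻¹]`: `k[u] = span_k {uⁿ}` for `u = T^e`, as sets. [folklore] -/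
theorem adjoin_T_eq_span (e : ℤ) :
    (Algebra.adjoin k {(T e : LaurentPolynomial k)} : Set (LaurentPolynomial k)) =
      Submodule.span k ((fun n : ℕ => (T (n * e) : LaurentPolynomial k)) '' Set.univ) := by
  have := congrArg SetLike.coe (Algebra.adjoin_eq_span (R := k) ({T e} : Set (LaurentPolynomial k)))
  simp only [Subalgebra.coe_toSubmodule] at this
  rw [this, Submonoid.closure_singleton_eq]
  congr 2
  ext f
  simp [T_pow, eq_comm]

/-- A linear equivalence maps spans to spans (as sets). [folklore] -/
theorem image_coe_span {M M₂ : Type*} [AddCommGroup M] [Module k M] [AddCommGroup M₂] [Module k M₂]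
    (g : M ≃ₗ[k] M₂) (S : Set M) :
    g '' (Submodule.span k S : Set M) = (Submodule.span k (g '' S) : Set M₂) := by
  have := Submodule.span_image (g : M →ₗ[k] M₂) (s := S)
  rw [LinearEquiv.coe_coe] at this
  rw [this, Submodule.map_coe, LinearEquiv.coe_coe]

/-- An algebra equivalence maps spans to spans (as sets). [folklore] -/
theorem image_coe_span_algEquiv {A B : Type*} [CommRing A] [Algebra k A] [CommRing B] [Algebra k B]
    (e : A ≃ₐ[k] B) (S : Set A) :
    (e : A →ₐ[k] B) '' (Submodule.span k S : Set A) = (Submodule.span k ((e : A →ₐ[k] B) '' S) : Set B) := by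
  have : ((e : A →ₐ[k] B) : A → B) = e.toLinearEquiv := rfl
  rw [this]
  exact image_coe_span k e.toLinearEquiv S

/-- The image of an algebra map out of `(k[x]_{xᵢ})₀ ≅ k[X]` is `k[image of the generator]`.
[folklore] -/
theorem range_comp_polyEquiv (i : Fin 2) {B : Type*} [CommRing B] [Algebra k B]
    (g : Away (MvPolynomial.homogeneousSubmodule (Fin 2) k) (X i : MvPolynomial (Fin 2) k) →ₐ[k] B) :
    Set.range g = (Algebra.adjoin k {g (chartGen k i 0)} : Set B) := by
  have hsurj : Function.Surjective (polyEquiv k i) := (polyEquiv k i).surjective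
  have h1 : Set.range g = Set.range (g.comp (polyEquiv k i : Polynomial k →ₐ[k] _)) := by
    ext b
    simp only [Set.mem_range, AlgHom.coe_comp, Function.comp_apply]
    constructor
    · rintro ⟨a, rfl⟩
      obtain ⟨p, rfl⟩ := hsurj a
      exact ⟨p, rfl⟩
    · rintro ⟨p, rfl⟩
      exact ⟨_, rfl⟩
  have h2 : g.comp (polyEquiv k i : Polynomial k →ₐ[k] _) = Polynomial.aeval (g (chartGen k i 0)) :=
    Polynomial.algHom_ext (by simp [polyEquiv_X])
  rw [h1, h2, Algebra.adjoin_singleton_eq_range_aeval]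
  rfl

/-- **The image of the chart `x₀` in the overlap is `k[t] = span_k {ℓ j | j ≥ 0}`.** [folklore] -/
theorem range_res₀ : Set.range (res₀ k) = Submodule.span k (ℓ k '' {j | 0 ≤ j}) := by
  have h := range_comp_polyEquiv k 0 (res₀ₐ k)
  have hg : (res₀ₐ k) (chartGen k 0 0) =
      (laurentAlgEquiv k : LaurentPolynomial k →ₐ[k] Λ) (LaurentPolynomial.T 1) := by
    change res₀ k (tgen k) = laurentEquiv k _
    rw [laurentEquiv_T_one]
  have hset : (laurentAlgEquiv k : LaurentPolynomial k →ₐ[k] Λ) ''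
      ((fun n : ℕ => (LaurentPolynomial.T (n * 1) : LaurentPolynomial k)) '' Set.univ) =
      ℓ k '' {j | 0 ≤ j} := by
    ext x
    simp only [Set.mem_image, Set.mem_univ, true_and, Set.mem_setOf_eq, ℓ_apply, mul_one]
    constructor
    · rintro ⟨_, ⟨n, rfl⟩, rfl⟩
      exact ⟨n, by positivity, rfl⟩
    · rintro ⟨j, hj, rfl⟩
      exact ⟨_, ⟨j.toNat, rfl⟩, by rw [Int.toNat_of_nonneg hj]; rfl⟩
  change Set.range (res₀ₐ k) = _
  rw [h, hg, ← Set.image_singleton, Algebra.adjoin_image, Subalgebra.coe_map, adjoin_T_eq_span,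
    image_coe_span_algEquiv, hset]

/-- **The image of the chart `x₁` in the overlap is `k[t⁻¹] = span_k {ℓ j | j ≤ 0}.** [folklore] -/
theorem range_res₁ : Set.range (res₁ k) = Submodule.span k (ℓ k '' {j | j ≤ 0}) := by
  have h := range_comp_polyEquiv k 1 (res₁ₐ k)
  have hg : (res₁ₐ k) (chartGen k 1 0) =
      (laurentAlgEquiv k : LaurentPolynomial k →ₐ[k] Λ) (LaurentPolynomial.T (-1)) := by
    change res₁ k (sgen k) = laurentEquiv k _
    rw [laurentEquiv_T_neg_one]
  have hset : (laurentAlgEquiv k : LaurentPolynomial k →ₐ[k] Λ) ''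
      ((fun n : ℕ => (LaurentPolynomial.T (n * (-1)) : LaurentPolynomial k)) '' Set.univ) =
      ℓ k '' {j | j ≤ 0} := by
    ext x
    simp only [Set.mem_image, Set.mem_univ, true_and, Set.mem_setOf_eq, ℓ_apply, mul_neg, mul_one]
    constructor
    · rintro ⟨_, ⟨n, rfl⟩, rfl⟩
      exact ⟨-(n : ℤ), by omega, rfl⟩
    · rintro ⟨j, hj, rfl⟩
      exact ⟨_, ⟨(-j).toNat, rfl⟩, by rw [Int.toNat_of_nonneg (by omega), neg_neg]; rfl⟩
  change Set.range (res₁ₐ k) = _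
  rw [h, hg, ← Set.image_singleton, Algebra.adjoin_image, Subalgebra.coe_map, adjoin_T_eq_span,
    image_coe_span_algEquiv, hset]

end P1Charts


section ProjBasicOpen

universe u

open CategoryTheory _root_.AlgebraicGeometry TopologicalSpace Opposite
open Literature.AlgebraicGeometry.Motives (GeneratingSections.res)
open Literature.AlgebraicGeometry.Motives.ProjLine (res_awayι_awayToSection)

/-! ### `D₊(fg)` is the basic open of the section `g^{deg f}/f^{deg g}` over `D₊(f)` -/

/-- **`D₊(f g) = D(t)` for the section `t = g^{d}/f^{e}` of `𝒪(D₊(f))`** (`f ∈ 𝒜_d`, `g ∈ 𝒜_e`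
of positive degree): both opens lie in `D₊(f)`, the image of the open immersion
`Spec A_{(f)} → Proj A`, and have the same preimage `D(t) ⊆ Spec A_{(f)}` (Mathlib
`Proj.awayι_preimage_basicOpen`; the section `t` pulls back to `t`). [folklore] -/
theorem Proj.basicOpen_mul_eq_basicOpen_awayToSection {R A : Type u} [CommRing R] [CommRing A]
    [Algebra R A] (𝒜 : ℕ → Submodule R A) [GradedAlgebra 𝒜] {f g : A} {m m' : ℕ}
    (f_deg : f ∈ 𝒜 m) (g_deg : g ∈ 𝒜 m') (hm : 0 < m) (hm' : 0 < m') :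
    Proj.basicOpen 𝒜 (f * g) =
      (Proj 𝒜).basicOpen (Proj.awayToSection 𝒜 f (Away.isLocalizationElem f_deg g_deg)) := by
  have hrange : (Proj.awayι 𝒜 f f_deg hm).opensRange = Proj.basicOpen 𝒜 f :=
    Proj.opensRange_awayι ..
  have htop : ⊤ ≤ Proj.awayι 𝒜 f f_deg hm ⁻¹ᵁ Proj.basicOpen 𝒜 f := by
    rw [← hrange, Scheme.Hom.preimage_opensRange]
  have h1 : Proj.awayι 𝒜 f f_deg hm ⁻¹ᵁ Proj.basicOpen 𝒜 (f * g) =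
      PrimeSpectrum.basicOpen (Away.isLocalizationElem f_deg g_deg) := by
    rw [Proj.basicOpen_mul]
    change Proj.awayι 𝒜 f f_deg hm ⁻¹ᵁ Proj.basicOpen 𝒜 f ⊓
      Proj.awayι 𝒜 f f_deg hm ⁻¹ᵁ Proj.basicOpen 𝒜 g = _
    rw [top_le_iff.mp htop, top_inf_eq, Proj.awayι_preimage_basicOpen 𝒜 f_deg hm g_deg hm']
  have h2 : Proj.awayι 𝒜 f f_deg hm ⁻¹ᵁ
      (Proj 𝒜).basicOpen (Proj.awayToSection 𝒜 f (Away.isLocalizationElem f_deg g_deg)) =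
      PrimeSpectrum.basicOpen (Away.isLocalizationElem f_deg g_deg) := by
    have := Scheme.basicOpen_appLE (Proj.awayι 𝒜 f f_deg hm) ⊤ (Proj.basicOpen 𝒜 f) htop
      (Proj.awayToSection 𝒜 f (Away.isLocalizationElem f_deg g_deg))
    rw [top_inf_eq] at this
    rw [← this]
    change (Spec _).basicOpen (GeneratingSections.res (Proj.awayι 𝒜 f f_deg hm)
      (Proj.basicOpen 𝒜 f) htop (Proj.awayToSection 𝒜 f _)) = _
    rw [res_awayι_awayToSection, basicOpen_eq_of_affine]
  have key : ∀ W : (Proj 𝒜).Opens, W ≤ Proj.basicOpen 𝒜 f →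
      Proj.awayι 𝒜 f f_deg hm ''ᵁ (Proj.awayι 𝒜 f f_deg hm ⁻¹ᵁ W) = W := fun W hW => by
    rw [Scheme.Hom.image_preimage_eq_opensRange_inf, hrange, inf_eq_right.mpr hW]
  rw [← key (Proj.basicOpen 𝒜 (f * g)) (by rw [Proj.basicOpen_mul]; exact inf_le_left),
    ← key ((Proj 𝒜).basicOpen (Proj.awayToSection 𝒜 f (Away.isLocalizationElem f_deg g_deg)))
      ((Proj 𝒜).basicOpen_le _), h1, h2]

end ProjBasicOpen

end Literature.AlgebraicGeometry.FundamentalGroup
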